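import Literature.NumberTheory.GelbartRogawski1991.UnitaryDualPairSeesawDeepLevelFixed
import Literature.NumberTheory.GelbartRogawski1991.UnitaryDualPairSeesawSmallMajorants
import Literature.NumberTheory.Weil1964.AdelicMetaplecticFinRep
import Literature.RepresentationTheory.TwistedCoinvariants
import HarnessLib

-- buildfix G11b-3 recipe (LEDGER B13-1/B13-3): elaborate sequentially so the trailing `attribute [implicit_reducible]`
-- block (reducibilityCoreExt is keyed to the async environment branch) is in force at `.olean` export.
set_option Elab.async false

/-!
# The finite Weil representation of a finite-adelic unitary dual pair and its central (`χ`-)coinvariants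

[Liu2021, App. D §D.1, Steps 1–3] (FJcycle.tex l. 5214–5219) constructs the local oscillator representation
`ω(μ_v, ε_v, χ_v)` of `U(V)(F_v)` as «the maximal quotient of the representation `ω(ε,μ)` of `U(V)` with central
character `χ`», where `ω(μ, ε) = ω(ε) ∘ ι_μ` is the Weil representation pulled back along a splitting
`ι_μ : U(V) → Mp(V_ε)`; [Liu2021, Def. 4.11] (l. 2092–2096) puts `ω(μ, ε, χ) := ⊗'_v ω(μ_v, ε_v, χ_v)`, «an irreducible
admissible representation of `𝔾(𝔸_F^∞)`».  This file builds the FINITE-ADELIC object as kernel mathematics over the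
tree's adelic metaplectic group and the unitary dual pair of [GelbartRogawski1991, §3.1]:

* for a COMPATIBLE pair splitting `s : U(J_V)(𝔸_F) ×' U(J_W)(𝔸_F) →* Mp_ψ(𝕎_𝔸)ᶜᵒⁿᵗ`
  (`(UnitaryDualPair.splittingDatum …).IsCompatible s`), the finite Weil representation of the finite-adelic dual pair
  **`finPairRep … hs : Representation ℂ (U(J_V)(𝔸_{F,f}) × U(J_W)(𝔸_{F,f})) 𝒮((𝔸_F^∞)^{N·M})`**
  (`Weil1964.finRepMp` of `pairSmall₁ s ∘ ((k, u) ↦ ((1,k), (1,u)))`; the archimedean-vector hypothesis `harch` is the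
  tree's `proj_pairSmall₁_finAdelic_apply_archVec`), its two commuting members `finPairRepV` / `finPairRepW`
  (`commute_finPairRepV_finPairRepW`), and (§2a) the `arch ⊗ fin` FACTORISATION of `ω_ψ ∘ s_pair` at finite-adelic pair
  points on every pure tensor (`omega_pairSmall₁_finPairToAdelic_tmul` in the Kronecker currency,
  `pairRep_finPairToAdelic_piSBReindex_tmul` in the `Fin n` currency);
* for a character `χ : U(J_W)(𝔸_{F,f}) →* ℂˣ`, the central coinvariants
  **`weilCoinv … χ hs : Representation ℂ U(J_V)(𝔸_{F,f}) (TwistedCoinv.Coinv (finPairRepW … hs) χ)`** — the maximal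
  quotient of `𝒮((𝔸_F^∞)^{NM})` on which `U(J_W)(𝔸_{F,f})` acts through `χ` (`weilCoinv_mk`, `mk_finPairRep_one`,
  `mk_finPairRep`), with the universal property re-exported (**`weilCoinvLift`**, `weilCoinvLift_mk`,
  `range_weilCoinvLift`, `weilCoinvLift_eq_zero_iff`, `U(J_V)`-equivariance `weilCoinvLift_weilCoinv` /
  `weilCoinvLift_comp_weilCoinv`) and the centre lemmas in pair shape (`weilCoinv_eq_smul_of_forall`,
  `char_apply_eq_of_intertwiner`, both UNDER the displayed hypothesis `hzw : ω_f(s_pair(z,1)) = c • ω_f(s_pair(1,w))`).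

For `M = 1` (`U(J_W) = E¹`, Liu's case) `weilCoinv … χ hs` is the finite part `⊗'_{v ∤ ∞} ω(μ_v, ε_v, χ_v)` of
[Liu2021, Def. 4.11] for the oscillator datum whose splitting `ι_μ` is `s` and whose symplectic form is the one carried by
the splitting datum (`ε`); the identification «maximal `χ`-quotient of the restricted tensor product = restricted tensor
product of the local maximal `χ_v`-quotients» (`E¹(𝔸_{F,f})` compact abelian) is NOT formalised here, nor is anything of
[Liu2021, Lemma D.1] (irreducibility, admissibility, non-vanishing for `n ≥ 3`, isomorphism criteria) — those stay the
tree's records (`Literature.RepresentationTheory.Liu2021.LocalOscillatorDatum.IrreducibleAdmissible`,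
`Literature.NumberTheory.Automorphic.Liu2021.Thm418Data` and its as-printed predicates).  Also NOT here (honest scope): the
identification of the scalar by which the common centre `E¹(𝔸_{F,f})` acts (`χ · c_s`, `c_s` valued in `ker π`), which
needs «`ker π` acts on `𝒮` by scalars» — carried in the tree as the hypothesis `hker` of
`SplittingDatum.IsCompatible.exists_central_twist`; the centre lemmas here are the generic statements such a discharge
feeds.  Central twists `s ⊗ ĉ` of the splitting ([GelbartRogawski1991, Remark p. 457]) are treated in the sibling file
`UnitaryDualPairWeilCoinvariantsTwist.lean`.  0 named facts, 0 hypothesis records: definitions + theorems only.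

## References
* [Liu2021] Y. Liu, *Fourier–Jacobi cycles and arithmetic relative trace formula*, Camb. J. Math. 9 (2021) =
  arXiv:2102.11518: Def. 4.11 (l. 2083–2097), App. D §D.1 Steps 1–3 (l. 5214–5219), Lemma D.1 (l. 5226–5233).
* [GelbartRogawski1991] S. Gelbart, J. Rogawski, *L-functions and Fourier–Jacobi coefficients for the unitary group
  U(3)*, Invent. Math. 105 (1991), §3.1 Prop. 3.1.1 p. 455, Remark p. 457.
* [Weil1964] A. Weil, *Sur certains groupes d'opérateurs unitaires*, Acta Math. 111 (1964), Chap. III n° 37–38.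
* [MoeglinVignerasWaldspurger1987] C. Mœglin, M.-F. Vignéras, J.-L. Waldspurger, LNM 1291 (1987), Chap. 2 II.2, Chap. 3 IV.
-/

noncomputable section

/-! ## §2. The finite Weil representation of the finite-adelic unitary dual pair and its central coinvariants -/

namespace Literature.NumberTheory.GelbartRogawski1991.UnitaryDualPair.WeilCoinv

open Literature.NumberTheory.GelbartRogawski1991 Literature.NumberTheory.GelbartRogawski1991.UnitaryDualPair
open Literature.NumberTheory.Automorphic Literature.NumberTheory.Weil1964
open scoped Kronecker
open NumberField
open Literature.RepresentationTheory

variable (F E : Type) [Field F] [NumberField F] [Field E] [NumberField E] [Algebra F E]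
variable (c : E ≃ₐ[F] E) (N M : ℕ) {n : ℕ} (e : Fin N × Fin M ≃ Fin n)
variable (JV : Matrix (Fin N) (Fin N) E) (JW : Matrix (Fin M) (Fin M) E)
variable {TV : Matrix (Fin N) (Fin N) F} {TW : Matrix (Fin M) (Fin M) F}

/-- The finite-adelic dual pair inside the adelic one: `(k, u) ↦ ((1, k), (1, u))`
(`UnitaryGroup.finAdelicToAdelic` on both members). [folklore] -/
def finPairToAdelic :
    UnitaryGroup.finAdelic F E c N JV × UnitaryGroup.finAdelic F E c M JW →*
      UnitaryGroup.adelic F E c N JV × UnitaryGroup.adelic F E c M JW :=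
  MonoidHom.prodMap (UnitaryGroup.finAdelicToAdelic F E c N JV) (UnitaryGroup.finAdelicToAdelic F E c M JW)

/-- `finPairToAdelic` on elements: both members through `finAdelicToAdelic`. [cite: GelbartRogawski1991, §3.1 Prop. 3.1.1 p. 455; Weil1964, Chap. III n° 37–39 pp. 187–190] -/
@[simp] theorem finPairToAdelic_apply (p : UnitaryGroup.finAdelic F E c N JV × UnitaryGroup.finAdelic F E c M JW) :
    finPairToAdelic F E c N M JV JW p =
      (UnitaryGroup.finAdelicToAdelic F E c N JV p.1, UnitaryGroup.finAdelicToAdelic F E c M JW p.2) := rfl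

variable [Algebra.IsQuadraticExtension F E] {δ : E} (hcδ : c δ = -δ) (hδ : δ ≠ 0) {d : F}
  (hd : δ * δ = algebraMap F E d) (hV : TV.IsSymm) (hW : TW.IsSymm) (hVd : IsUnit TV.det) (hWd : IsUnit TW.det)
  (hJV : JV = TV.map (algebraMap F E)) (hJW : JW = TW.map (algebraMap F E))
  {s : UnitaryGroup.adelicPair F E c N M JV JW →* adelicMpCont F (Fin n) (adelicGram F e TV TW)}

/-- **The finite Weil representation `ω_f ∘ s_pair` of the finite-adelic dual pair
`U(J_V)(𝔸_{F,f}) × U(J_W)(𝔸_{F,f})` on `𝒮((𝔸_F^∞)^{N M})`** through a COMPATIBLE pair splitting `s`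
(`Weil1964.finRepMp` of the pair splitting read back along `e`, `pairSmall₁ s`, at the finite-adelic points; the
archimedean-vector hypothesis is the tree's `proj_pairSmall₁_finAdelic_apply_archVec`).  This is the representation
whose local factors are Liu's `ω_v|_{U(V) × U(W)}` at the nonarchimedean places.
[cite: Weil1964, Chap. III n° 37–38 p. 188–190; GelbartRogawski1991, §3.1 Prop. 3.1.1 p. 455; Liu2021, App. D §D.1 Steps 2–3 (l. 5217–5219)] -/
def finPairRep (hs : (splittingDatum F E c N M e JV JW hcδ hδ hd hV hW hVd hWd hJV hJW).IsCompatible s) :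
    Representation ℂ (UnitaryGroup.finAdelic F E c N JV × UnitaryGroup.finAdelic F E c M JW)
      (FinSB F (Fin N × Fin M)) :=
  finRepMp (isUnit_kronecker_map F N hVd hWd)
    ((pairSmall₁ F E c N M e JV JW s).comp (finPairToAdelic F E c N M JV JW))
    (fun p a w => proj_pairSmall₁_finAdelic_apply_archVec F E c N M e JV JW hcδ hδ hd hV hW hVd hWd hJV hJW hs
      p.1 p.2 a w)

/-- its restriction to the `U(J_V)`-member, `k ↦ ω_f(s_pair((1,k), 1))`. [folklore] -/
def finPairRepV (hs : (splittingDatum F E c N M e JV JW hcδ hδ hd hV hW hVd hWd hJV hJW).IsCompatible s) :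
    Representation ℂ (UnitaryGroup.finAdelic F E c N JV) (FinSB F (Fin N × Fin M)) :=
  (finPairRep F E c N M e JV JW hcδ hδ hd hV hW hVd hWd hJV hJW hs).comp (MonoidHom.inl _ _)

/-- its restriction to the `U(J_W)`-member, `u ↦ ω_f(s_pair(1, (1,u)))`. [folklore] -/
def finPairRepW (hs : (splittingDatum F E c N M e JV JW hcδ hδ hd hV hW hVd hWd hJV hJW).IsCompatible s) :
    Representation ℂ (UnitaryGroup.finAdelic F E c M JW) (FinSB F (Fin N × Fin M)) :=
  (finPairRep F E c N M e JV JW hcδ hδ hd hV hW hVd hWd hJV hJW hs).comp (MonoidHom.inr _ _)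

/-- `finPairRepV k = finPairRep (k, 1)`. [cite: GelbartRogawski1991, §3.1 Prop. 3.1.1 p. 455; Weil1964, Chap. III n° 37–39 pp. 187–190] -/
theorem finPairRepV_apply (hs : (splittingDatum F E c N M e JV JW hcδ hδ hd hV hW hVd hWd hJV hJW).IsCompatible s)
    (k : UnitaryGroup.finAdelic F E c N JV) :
    finPairRepV F E c N M e JV JW hcδ hδ hd hV hW hVd hWd hJV hJW hs k =
      finPairRep F E c N M e JV JW hcδ hδ hd hV hW hVd hWd hJV hJW hs (k, 1) := rfl

/-- `finPairRepW u = finPairRep (1, u)`. [cite: GelbartRogawski1991, §3.1 Prop. 3.1.1 p. 455; Weil1964, Chap. III n° 37–39 pp. 187–190] -/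
theorem finPairRepW_apply (hs : (splittingDatum F E c N M e JV JW hcδ hδ hd hV hW hVd hWd hJV hJW).IsCompatible s)
    (u : UnitaryGroup.finAdelic F E c M JW) :
    finPairRepW F E c N M e JV JW hcδ hδ hd hV hW hVd hWd hJV hJW hs u =
      finPairRep F E c N M e JV JW hcδ hδ hd hV hW hVd hWd hJV hJW hs (1, u) := rfl

/-- `ω_f(s_pair(k, u)) = ω_f(s_pair(k, 1)) ω_f(s_pair(1, u))`. [cite: GelbartRogawski1991, §3.1 Prop. 3.1.1 p. 455; Weil1964, Chap. III n° 37–39 pp. 187–190] -/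
theorem finPairRep_eq_mul (hs : (splittingDatum F E c N M e JV JW hcδ hδ hd hV hW hVd hWd hJV hJW).IsCompatible s)
    (k : UnitaryGroup.finAdelic F E c N JV) (u : UnitaryGroup.finAdelic F E c M JW) :
    finPairRep F E c N M e JV JW hcδ hδ hd hV hW hVd hWd hJV hJW hs (k, u) =
      finPairRepV F E c N M e JV JW hcδ hδ hd hV hW hVd hWd hJV hJW hs k *
        finPairRepW F E c N M e JV JW hcδ hδ hd hV hW hVd hWd hJV hJW hs u := by
  rw [finPairRepV_apply, finPairRepW_apply, ← map_mul, Prod.mk_mul_mk, mul_one, one_mul]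

/-- **the two members commute** in the finite Weil representation (they commute in the product group).
[cite: GelbartRogawski1991, §3.1 Prop. 3.1.1 p. 455; Weil1964, Chap. III n° 37–39 pp. 187–190] -/
theorem commute_finPairRepV_finPairRepW
    (hs : (splittingDatum F E c N M e JV JW hcδ hδ hd hV hW hVd hWd hJV hJW).IsCompatible s)
    (k : UnitaryGroup.finAdelic F E c N JV) (u : UnitaryGroup.finAdelic F E c M JW) :
    Commute (finPairRepV F E c N M e JV JW hcδ hδ hd hV hW hVd hWd hJV hJW hs k)
      (finPairRepW F E c N M e JV JW hcδ hδ hd hV hW hVd hWd hJV hJW hs u) := by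
  change finPairRepV F E c N M e JV JW hcδ hδ hd hV hW hVd hWd hJV hJW hs k *
      finPairRepW F E c N M e JV JW hcδ hδ hd hV hW hVd hWd hJV hJW hs u =
    finPairRepW F E c N M e JV JW hcδ hδ hd hV hW hVd hWd hJV hJW hs u *
      finPairRepV F E c N M e JV JW hcδ hδ hd hV hW hVd hWd hJV hJW hs k
  rw [finPairRepV_apply, finPairRepW_apply, ← map_mul, ← map_mul, Prod.mk_mul_mk, Prod.mk_mul_mk, mul_one, one_mul,
    mul_one, one_mul]

/-! ### §2a  The `arch ⊗ fin` factorisation of `ω ∘ s_pair` at the finite-adelic points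

At a finite-adelic pair element `(ι k, ι u)` the honest pair representation acts on pure tensors `Φ_∞ ⊗ Φ_f` through the
finite factor alone: `ω(s_pair(ι k, ι u)) (Φ_∞ ⊗ Φ_f) = Φ_∞ ⊗ ω_f(k, u) Φ_f`, `ω_f = finPairRep`.  Stated in both Schwartz
currencies of the tree: the Kronecker currency `𝒮(𝔸^{N × M})` of `pairSmall₁ s` (Weil1964 `omega_map_tmul_finRepMp`) and the
`Fin n` currency `𝒮(𝔸^n)` of `pairRep s = ω_ψ ∘ s_pair` (read through the re-indexing `R_e = piSBReindex F e`, tree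
`omega_pairSmall₁_apply`; `R_e` is itself a pure-tensor operator, tree `piSBReindex_tmul`).
[cite: Weil1964, Chap. III n° 37–38 p. 188–190; GelbartRogawski1991, §3.1 p. 454] -/

section ArchFinFactorisation

open scoped SchwartzMap TensorProduct Classical
open NumberField.mixedEmbedding IsDedekindDomain

/-- **Kronecker currency**: `ω(pairSmall₁ s (ι k, ι u)) (Φ_∞ ⊗ Φ_f) = Φ_∞ ⊗ finPairRep s (k, u) Φ_f` for EVERY archimedean
`Φ_∞` and EVERY finite `Φ_f`. [cite: Weil1964, Chap. III n° 37–38 p. 188–190] -/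
theorem omega_pairSmall₁_finPairToAdelic_tmul
    (hs : (splittingDatum F E c N M e JV JW hcδ hδ hd hV hW hVd hWd hJV hJW).IsCompatible s)
    (p : UnitaryGroup.finAdelic F E c N JV × UnitaryGroup.finAdelic F E c M JW)
    (Φ : 𝓢(((Fin N × Fin M) → mixedSpace F), ℂ)) (f : FinSB F (Fin N × Fin M)) :
    adelicMpCont.omega F (Fin N × Fin M) _ (pairSmall₁ F E c N M e JV JW s (finPairToAdelic F E c N M JV JW p))
        (piSchwartzBruhatEquiv F (Fin N × Fin M) (Φ ⊗ₜ[ℂ] f)) =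
      piSchwartzBruhatEquiv F (Fin N × Fin M)
        (Φ ⊗ₜ[ℂ] finPairRep F E c N M e JV JW hcδ hδ hd hV hW hVd hWd hJV hJW hs p f) :=
  omega_map_tmul_finRepMp (isUnit_kronecker_map F N hVd hWd)
    ((pairSmall₁ F E c N M e JV JW s).comp (finPairToAdelic F E c N M JV JW))
    (fun p a w => proj_pairSmall₁_finAdelic_apply_archVec F E c N M e JV JW hcδ hδ hd hV hW hVd hWd hJV hJW hs
      p.1 p.2 a w) p Φ f

/-- **`Fin n` currency**: `(ω_ψ ∘ s_pair)(ι k, ι u) (R_e (Φ_∞ ⊗ Φ_f)) = R_e (Φ_∞ ⊗ finPairRep s (k, u) Φ_f)`, `R_e = piSBReindex F e`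
(so, with the tree's `piSBReindex_tmul`, `ω_ψ(s_pair(ι k, ι u))` is `1 ⊗ (R_e^f ∘ ω_f(k,u) ∘ (R_e^f)⁻¹)` on `𝒮(𝔸^n)`).
[cite: Weil1964, Chap. III n° 37–38 p. 188–190; GelbartRogawski1991, §3.1 p. 454] -/
theorem pairRep_finPairToAdelic_piSBReindex_tmul
    (hs : (splittingDatum F E c N M e JV JW hcδ hδ hd hV hW hVd hWd hJV hJW).IsCompatible s)
    (p : UnitaryGroup.finAdelic F E c N JV × UnitaryGroup.finAdelic F E c M JW)
    (Φ : 𝓢(((Fin N × Fin M) → mixedSpace F), ℂ)) (f : FinSB F (Fin N × Fin M)) :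
    pairRep F E c N M e JV JW s (finPairToAdelic F E c N M JV JW p)
        (piSBReindex F e (piSchwartzBruhatEquiv F (Fin N × Fin M) (Φ ⊗ₜ[ℂ] f))) =
      piSBReindex F e (piSchwartzBruhatEquiv F (Fin N × Fin M)
        (Φ ⊗ₜ[ℂ] finPairRep F E c N M e JV JW hcδ hδ hd hV hW hVd hWd hJV hJW hs p f)) := by
  rw [← omega_pairSmall₁_finPairToAdelic_tmul F E c N M e JV JW hcδ hδ hd hV hW hVd hWd hJV hJW hs p Φ f,
    omega_pairSmall₁_apply, LinearEquiv.apply_symm_apply]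

end ArchFinFactorisation

variable (χ : UnitaryGroup.finAdelic F E c M JW →* ℂˣ)

/-- **`Ω(s, χ)`: the `χ`-coinvariants of `ω_f ∘ s_pair` under the second member `U(J_W)(𝔸_{F,f})`, as a
representation of `U(J_V)(𝔸_{F,f})`** — the maximal quotient of `𝒮((𝔸_F^∞)^{NM})` on which `U(J_W)(𝔸_{F,f})` acts
through `χ`.  For `M = 1` the group `U(J_W)(𝔸_{F,f})` is the norm-one torus `E¹(𝔸_{F,f})`, which is also the centre
of `U(J_V)` ([Mok2014, §1]; tree `UnitaryGroup.adelicCenter`), and [Liu2021, App. D §D.1 Step 3] takes «the maximal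
quotient of `ω(ε,μ)` with central character `χ`»; since `s` is a homomorphism on `G₁(𝔸_F) ⊇ U(J_V) × U(J_W)` and
`(u·1_V) ⊗ 1 · 1 ⊗ (u⁻¹·1_W) = 1` there (tree `UnitaryGroup.adelicInl_adelicCenter_mul_adelicInr_adelicCenter_inv`),
the centre of `U(J_V)` and `U(J_W) = U(1)` act on `𝒮` by the SAME operators, so for `M = 1` this is Liu's finite-adelic
`ω(μ, ε, χ) = ⊗'_{v ∤ ∞} ω(μ_v, ε_v, χ_v)` for the oscillator datum whose splitting `ι_μ` is `s` — the kernel proof of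
that identification (a finite-adelic centre embedding + `weilCoinv_eq_smul_of_forall` with `c₀ = 1`) is NOT in this
file.  At the data `(L⁺, L, complexConj, 3, V.Hm)` of a hermitian space of rank 3 over a CM field the acting group
`↥(UnitaryGroup.finAdelic …)` is `U(V)(𝔸_{L⁺,f})`.
[cite: Liu2021, Def. 4.11 (l. 2092–2096); App. D §D.1 Step 3 (l. 5219)] -/
def weilCoinv (hs : (splittingDatum F E c N M e JV JW hcδ hδ hd hV hW hVd hWd hJV hJW).IsCompatible s) :
    Representation ℂ (UnitaryGroup.finAdelic F E c N JV)
      (TwistedCoinv.Coinv (finPairRepW F E c N M e JV JW hcδ hδ hd hV hW hVd hWd hJV hJW hs) χ) :=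
  TwistedCoinv.rep χ (finPairRepV F E c N M e JV JW hcδ hδ hd hV hW hVd hWd hJV hJW hs)
    (commute_finPairRepV_finPairRepW F E c N M e JV JW hcδ hδ hd hV hW hVd hWd hJV hJW hs)

/-- `Ω(s, χ)` on generators: `weilCoinv k (mk f) = mk (ω_f(s_pair(k, 1)) f)`. [cite: Liu2021, App. D §D.1 Step 3 (l. 5219)] -/
@[simp] theorem weilCoinv_mk (hs : (splittingDatum F E c N M e JV JW hcδ hδ hd hV hW hVd hWd hJV hJW).IsCompatible s)
    (k : UnitaryGroup.finAdelic F E c N JV) (f : FinSB F (Fin N × Fin M)) :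
    weilCoinv F E c N M e JV JW hcδ hδ hd hV hW hVd hWd hJV hJW χ hs k
        (TwistedCoinv.mk (finPairRepW F E c N M e JV JW hcδ hδ hd hV hW hVd hWd hJV hJW hs) χ f) =
      TwistedCoinv.mk (finPairRepW F E c N M e JV JW hcδ hδ hd hV hW hVd hWd hJV hJW hs) χ
        (finPairRep F E c N M e JV JW hcδ hδ hd hV hW hVd hWd hJV hJW hs (k, 1) f) := rfl

/-- `U(J_W)(𝔸_{F,f})` acts on `Ω(s, χ)` through `χ`: `mk (ω_f(s_pair(1, u)) f) = χ u • mk f`. [cite: Liu2021, App. D §D.1 Step 3 (l. 5219)] -/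
theorem mk_finPairRep_one (hs : (splittingDatum F E c N M e JV JW hcδ hδ hd hV hW hVd hWd hJV hJW).IsCompatible s)
    (u : UnitaryGroup.finAdelic F E c M JW) (f : FinSB F (Fin N × Fin M)) :
    TwistedCoinv.mk (finPairRepW F E c N M e JV JW hcδ hδ hd hV hW hVd hWd hJV hJW hs) χ
        (finPairRep F E c N M e JV JW hcδ hδ hd hV hW hVd hWd hJV hJW hs (1, u) f) =
      ((χ u : ℂˣ) : ℂ) •
        TwistedCoinv.mk (finPairRepW F E c N M e JV JW hcδ hδ hd hV hW hVd hWd hJV hJW hs) χ f :=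
  TwistedCoinv.mk_ρW _ χ u f

/-- the pair on `Ω(s, χ)`: `mk (ω_f(s_pair(k, u)) f) = χ u • weilCoinv k (mk f)`. [cite: Liu2021, App. D §D.1 Step 3 (l. 5219)] -/
theorem mk_finPairRep (hs : (splittingDatum F E c N M e JV JW hcδ hδ hd hV hW hVd hWd hJV hJW).IsCompatible s)
    (k : UnitaryGroup.finAdelic F E c N JV) (u : UnitaryGroup.finAdelic F E c M JW) (f : FinSB F (Fin N × Fin M)) :
    TwistedCoinv.mk (finPairRepW F E c N M e JV JW hcδ hδ hd hV hW hVd hWd hJV hJW hs) χ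
        (finPairRep F E c N M e JV JW hcδ hδ hd hV hW hVd hWd hJV hJW hs (k, u) f) =
      ((χ u : ℂˣ) : ℂ) •
        weilCoinv F E c N M e JV JW hcδ hδ hd hV hW hVd hWd hJV hJW χ hs k
          (TwistedCoinv.mk (finPairRepW F E c N M e JV JW hcδ hδ hd hV hW hVd hWd hJV hJW hs) χ f) := by
  rw [finPairRep_eq_mul, Module.End.mul_apply]
  exact TwistedCoinv.mk_ρV_ρW χ _ (commute_finPairRepV_finPairRepW F E c N M e JV JW hcδ hδ hd hV hW hVd hWd hJV hJW hs)
    k u f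

section Lift

variable {H : Type*} [AddCommGroup H] [Module ℂ H]

/-- **`θ̄`-shape universal property**: a linear map `f : 𝒮((𝔸_F^∞)^{NM}) → H` with
`f (ω_f(s_pair(1, u)) φ) = χ u • f φ` factors through `Ω(s, χ)`. [folklore] -/
def weilCoinvLift (hs : (splittingDatum F E c N M e JV JW hcδ hδ hd hV hW hVd hWd hJV hJW).IsCompatible s)
    (f : FinSB F (Fin N × Fin M) →ₗ[ℂ] H)
    (hf : ∀ (u : UnitaryGroup.finAdelic F E c M JW) (φ : FinSB F (Fin N × Fin M)),
      f (finPairRep F E c N M e JV JW hcδ hδ hd hV hW hVd hWd hJV hJW hs (1, u) φ) = ((χ u : ℂˣ) : ℂ) • f φ) :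
    TwistedCoinv.Coinv (finPairRepW F E c N M e JV JW hcδ hδ hd hV hW hVd hWd hJV hJW hs) χ →ₗ[ℂ] H :=
  TwistedCoinv.lift _ χ f hf

variable (hs : (splittingDatum F E c N M e JV JW hcδ hδ hd hV hW hVd hWd hJV hJW).IsCompatible s)
  (f : FinSB F (Fin N × Fin M) →ₗ[ℂ] H)
  (hf : ∀ (u : UnitaryGroup.finAdelic F E c M JW) (φ : FinSB F (Fin N × Fin M)),
    f (finPairRep F E c N M e JV JW hcδ hδ hd hV hW hVd hWd hJV hJW hs (1, u) φ) = ((χ u : ℂˣ) : ℂ) • f φ)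

/-- `weilCoinvLift f hf (mk φ) = f φ`. [cite: Liu2021, App. D §D.1 Step 3 (l. 5219)] -/
@[simp] theorem weilCoinvLift_mk (φ : FinSB F (Fin N × Fin M)) :
    weilCoinvLift F E c N M e JV JW hcδ hδ hd hV hW hVd hWd hJV hJW χ hs f hf
        (TwistedCoinv.mk (finPairRepW F E c N M e JV JW hcδ hδ hd hV hW hVd hWd hJV hJW hs) χ φ) = f φ := rfl

/-- **`range θ̄ = range (f)`** — the image of the factored map is the image of `f` (for `f = P_χ ∘ θ`: the theta
`χ`-module). [cite: Liu2021, App. D §D.1 Step 3 (l. 5219)] -/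
theorem range_weilCoinvLift :
    LinearMap.range (weilCoinvLift F E c N M e JV JW hcδ hδ hd hV hW hVd hWd hJV hJW χ hs f hf) = LinearMap.range f :=
  TwistedCoinv.range_lift _ χ f hf

/-- the factored map vanishes iff `f` does. [cite: Liu2021, App. D §D.1 Step 3 (l. 5219)] -/
theorem weilCoinvLift_eq_zero_iff :
    weilCoinvLift F E c N M e JV JW hcδ hδ hd hV hW hVd hWd hJV hJW χ hs f hf = 0 ↔ f = 0 :=
  TwistedCoinv.lift_eq_zero_iff _ χ f hf

/-- **`U(J_V)(𝔸_{F,f})`-equivariance of `θ̄`**: if `f` intertwines `ω_f(s_pair(k, 1))` with a representation `σ`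
of `U(J_V)(𝔸_{F,f})` on `H` (right translation on theta functions), then `θ̄ ∘ Ω(s,χ)(k) = σ(k) ∘ θ̄`. [cite: Liu2021, App. D §D.1 Step 3 (l. 5219)] -/
theorem weilCoinvLift_weilCoinv (σ : Representation ℂ (UnitaryGroup.finAdelic F E c N JV) H)
    (hσ : ∀ (k : UnitaryGroup.finAdelic F E c N JV) (φ : FinSB F (Fin N × Fin M)),
      f (finPairRep F E c N M e JV JW hcδ hδ hd hV hW hVd hWd hJV hJW hs (k, 1) φ) = σ k (f φ))
    (k : UnitaryGroup.finAdelic F E c N JV)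
    (x : TwistedCoinv.Coinv (finPairRepW F E c N M e JV JW hcδ hδ hd hV hW hVd hWd hJV hJW hs) χ) :
    weilCoinvLift F E c N M e JV JW hcδ hδ hd hV hW hVd hWd hJV hJW χ hs f hf
        (weilCoinv F E c N M e JV JW hcδ hδ hd hV hW hVd hWd hJV hJW χ hs k x) =
      σ k (weilCoinvLift F E c N M e JV JW hcδ hδ hd hV hW hVd hWd hJV hJW χ hs f hf x) :=
  TwistedCoinv.lift_rep χ _ _ f hf σ hσ k x

/-- the same as an identity of linear maps. [cite: Liu2021, App. D §D.1 Step 3 (l. 5219)] -/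
theorem weilCoinvLift_comp_weilCoinv (σ : Representation ℂ (UnitaryGroup.finAdelic F E c N JV) H)
    (hσ : ∀ (k : UnitaryGroup.finAdelic F E c N JV) (φ : FinSB F (Fin N × Fin M)),
      f (finPairRep F E c N M e JV JW hcδ hδ hd hV hW hVd hWd hJV hJW hs (k, 1) φ) = σ k (f φ))
    (k : UnitaryGroup.finAdelic F E c N JV) :
    weilCoinvLift F E c N M e JV JW hcδ hδ hd hV hW hVd hWd hJV hJW χ hs f hf ∘ₗ
        weilCoinv F E c N M e JV JW hcδ hδ hd hV hW hVd hWd hJV hJW χ hs k =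
      σ k ∘ₗ weilCoinvLift F E c N M e JV JW hcδ hδ hd hV hW hVd hWd hJV hJW χ hs f hf :=
  LinearMap.ext (weilCoinvLift_weilCoinv F E c N M e JV JW hcδ hδ hd hV hW hVd hWd hJV hJW χ hs f hf σ hσ k)

end Lift

/-- **Centre clause, dual-pair shape**: if a `U(J_V)`-member `z` and a `U(J_W)`-member `w` have finite Weil
operators differing by a scalar `c` (the common centre `E¹(𝔸_{F,f})`: `ι(z ⊗ 1) = ι(1 ⊗ w)`, the two values of the
splitting differ by `ker π`, which acts by scalars by Schur's lemma for `ρ_ψ`), then `z` acts on `Ω(s, χ)` by the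
scalar `c · χ w`. [cite: GelbartRogawski1991, §3.1 Remark p. 457 L4–13; Liu2021, App. D §D.1 Step 3 (l. 5219)] -/
theorem weilCoinv_eq_smul_of_forall
    (hs : (splittingDatum F E c N M e JV JW hcδ hδ hd hV hW hVd hWd hJV hJW).IsCompatible s)
    {z : UnitaryGroup.finAdelic F E c N JV} {w : UnitaryGroup.finAdelic F E c M JW} {c₀ : ℂ}
    (hzw : ∀ φ : FinSB F (Fin N × Fin M),
      finPairRep F E c N M e JV JW hcδ hδ hd hV hW hVd hWd hJV hJW hs (z, 1) φ =
        c₀ • finPairRep F E c N M e JV JW hcδ hδ hd hV hW hVd hWd hJV hJW hs (1, w) φ)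
    (x : TwistedCoinv.Coinv (finPairRepW F E c N M e JV JW hcδ hδ hd hV hW hVd hWd hJV hJW hs) χ) :
    weilCoinv F E c N M e JV JW hcδ hδ hd hV hW hVd hWd hJV hJW χ hs z x = (c₀ * ((χ w : ℂˣ) : ℂ)) • x :=
  TwistedCoinv.rep_eq_smul_of_forall χ _ _ hzw x

/-- **Distinct central characters give no non-zero intertwiner** (the algebra of [Liu2021, App. D Lemma D.1 (3)]
for one splitting and two characters): under the centre relation `ω_f(s_pair(z,1)) = c • ω_f(s_pair(1,w))` with
`c ≠ 0`, a `z`-intertwiner `Ω(s, χ) → Ω(s, χ')` with a non-zero value forces `χ w = χ' w`. [cite: Liu2021, App. D Lemma D.1 (3) (l. 5233)] -/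
theorem char_apply_eq_of_intertwiner
    (hs : (splittingDatum F E c N M e JV JW hcδ hδ hd hV hW hVd hWd hJV hJW).IsCompatible s)
    (χ' : UnitaryGroup.finAdelic F E c M JW →* ℂˣ)
    {z : UnitaryGroup.finAdelic F E c N JV} {w : UnitaryGroup.finAdelic F E c M JW} {c₀ : ℂ} (hc0 : c₀ ≠ 0)
    (hzw : ∀ φ : FinSB F (Fin N × Fin M),
      finPairRep F E c N M e JV JW hcδ hδ hd hV hW hVd hWd hJV hJW hs (z, 1) φ =
        c₀ • finPairRep F E c N M e JV JW hcδ hδ hd hV hW hVd hWd hJV hJW hs (1, w) φ)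
    (T : TwistedCoinv.Coinv (finPairRepW F E c N M e JV JW hcδ hδ hd hV hW hVd hWd hJV hJW hs) χ →ₗ[ℂ]
      TwistedCoinv.Coinv (finPairRepW F E c N M e JV JW hcδ hδ hd hV hW hVd hWd hJV hJW hs) χ')
    (hT : ∀ x, T (weilCoinv F E c N M e JV JW hcδ hδ hd hV hW hVd hWd hJV hJW χ hs z x) =
      weilCoinv F E c N M e JV JW hcδ hδ hd hV hW hVd hWd hJV hJW χ' hs z (T x))
    {x : TwistedCoinv.Coinv (finPairRepW F E c N M e JV JW hcδ hδ hd hV hW hVd hWd hJV hJW hs) χ} (hx : T x ≠ 0) :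
    χ w = χ' w :=
  TwistedCoinv.char_apply_eq_of_intertwiner χ χ' _ _ hc0 hzw T hT hx

/-! ### Build-lane note (ops-buildfix G11b-3 recipe, LEDGER B13-1, 2026-08-21)
`lean -o` (the hub build lane, never `lean`/the gate check) runs Lean 4.32's library-suggestion indexers
(`Lean.LibrarySuggestions.SymbolFrequency` / `SineQuaNon`, from their `exportEntriesFn`) over the statement of
every local theorem that is not a denied premise; on this family's statements (very large dependent binder
telescopes through the theta-kernel / dual-pair data) that fold runs for tens of minutes to hours and the build
lane kills the job (incident G11b-3, run/shared/lean/ops/buildfix/G11b-3-DOSSIER.md). `isDeniedPremise` skips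
`[implicit_reducible]` constants before any fold, and a reducibility status on a *theorem* is inert (Meta never
unfolds `thmInfo`; the kernel ignores the attribute), so the public theorems of this file are tagged
`[implicit_reducible]` purely to keep them out of that index. Only other effect: they are not offered by
`+suggestions` premise selectors. No statement or proof is changed; superseded if the operator lands a
deny-list form (`HarnessLib.PremiseIndex`). -/
set_option allowUnsafeReducibility true in
attribute [implicit_reducible]
  finPairToAdelic_apply finPairRepV_apply finPairRepW_apply finPairRep_eq_mul
  commute_finPairRepV_finPairRepW omega_pairSmall₁_finPairToAdelic_tmul
  pairRep_finPairToAdelic_piSBReindex_tmul weilCoinv_mk mk_finPairRep_one mk_finPairRep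
  weilCoinvLift_mk range_weilCoinvLift weilCoinvLift_eq_zero_iff weilCoinvLift_weilCoinv
  weilCoinvLift_comp_weilCoinv weilCoinv_eq_smul_of_forall char_apply_eq_of_intertwiner

end Literature.NumberTheory.GelbartRogawski1991.UnitaryDualPair.WeilCoinv
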